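import Literature.NumberTheory.LFunctions.Zhang2022.Section8Lemma82
import HarnessLib

/-!
# Zhang (2022), §8, Lemma 8.2 — the range extension `x ≤ P^λ`

Y. Zhang, *Discrete mean estimates and the Landau–Siegel zero*, arXiv:2211.02515v2, §8, Lemma 8.2
(p. 16): for `β_j ∈ {β₁, β₂, β₃}`, `β_μ ∈ {β₆, β₇}` and `T ≤ x ≤ P`,
`∑_{m<x} χ(m) m^{β_j−1} (x/m)^{β_μ} log(x/m) = L′(1,χ) 𝔣_{jμ}(x) + O(𝓛⁻⁶)`.
The tree's `Section8Lemma82` proves this verbatim (`Lemma82.lemma_8_2_general`, `Lemma82.lemma_8_2`)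
on the printed range `T = exp(𝓛^{1.1}) ≤ x ≤ P = exp(𝓛⁹)`.

This file (theorems only, no new definitions, no named facts) records that the **same proof gives
the lemma on the longer range `T ≤ x ≤ P^λ = exp(λ𝓛⁹)`, any fixed `λ ≥ 1`, with the constant
multiplied by `(1 + 2λ)`** — the "Lemma 8.2 range extension" line item (p5) of the long-pairs
bookkeeping (lengths up to `D⁵P²` occur for non-short in-class pairs). In the printed proof the
upper range enters at exactly one place: the evaluation of the residue at the double pole by
Lemma 5.8, where `log x ≤ 𝓛⁹` keeps `|β log x| ≤ Kπ` bounded (`Lemma82.norm_residue_sub_main_le`,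
hypothesis `log x ≤ 𝓛⁹`). That residue expression,
`(log x)·L(1+δ,χ) + L′(1+δ,χ) − L′(1,χ)(1 + δ log x)`, is **affine in `log x`**, so its bound on
`0 ≤ log x ≤ λ𝓛⁹` follows from the two instances `x = 1` and `x = P` of the tree's theorem by linear
interpolation (`norm_residue_sub_main_le_of_le_exp_mul`, factor `1 + 2λ`); the Perron / line-shift
part of the proof (`Lemma82.sum_eq_integral`, `integral_vertical_sub_eq_sum_of_poles_dslope`,
`norm_integral_G_left_le`, `rpow_neg_inv_log_mul_le`) uses only `x ≥ T` and is re-run unchanged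
(`sum_twist_log_sub_main_le_of_le_exp_mul`). The general-shift, printed-shift and `ϰ`-weighted
(display after Lemma 8.4, levels `P₁ ≤ P^λ`) forms follow as in the tree file.

Lemma 8.4's kernel form `Lemma84Estimate.lemma84_core` already carries no upper range hypothesis
(`bigT D < y` only; its docstring: "the bound `y < P` is not needed here"), so no companion is needed
for it.

## Main statements

* `norm_residue_sub_main_le_of_le_exp_mul` — the residue estimate for `1 ≤ x ≤ exp(λ𝓛⁹)`.
* `sum_twist_log_sub_main_le_of_le_exp_mul` — the core estimate on `T ≤ x ≤ exp(λ𝓛⁹)`: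
  `‖∑_{m ≤ x} χ(m) m^{-1-δ} log(x/m) − L′(1,χ)(1 + δ log x)‖ ≤ (1 + 2λ) C82(K) 𝓛⁻⁶`.
* `lemma_8_2_general_of_le_exp_mul`, `lemma_8_2_of_le_exp_mul` — Lemma 8.2 (general / printed
  shifts) on `T ≤ x ≤ exp(λ𝓛⁹)`.
* `lemma_8_2_varkappa_of_le_exp_mul` — the consumed `ϰ`-form at any level `P₁ ≤ exp(λ𝓛⁹)`.

## References

* Y. Zhang, arXiv:2211.02515v2 (2022), §8 Lemma 8.2 (p. 16) and the display after Lemma 8.4;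
  §5 Lemma 5.8. [cite: Zhang2022LandauSiegel, §8, Lemma 8.2]
* H. L. Montgomery, R. C. Vaughan, *Multiplicative Number Theory I*, CUP 2007, §5.1 (5.21)–(5.22)
  (Perron for Riesz means). [cite: MontgomeryVaughan2007, §5.1]
-/

noncomputable section

open Complex Filter Topology Set Real MeasureTheory

namespace Literature.NumberTheory.LFunctions.Zhang2022.Lemma82

variable {q : ℕ} [NeZero q] (χ : DirichletCharacter ℂ q)

/-! ### §1. The residue estimate on the longer range (affine interpolation) -/

/-- **Residue estimate, range `1 ≤ x ≤ P^λ`.** For `χ` primitive mod `D`, `𝓛 = log D ≥ 3`,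
(A) `‖L(1,χ)‖ ≤ 𝓛^{-2022}`, `4Kπ ≤ 𝓛⁸`, `‖δ‖ ≤ Kα` and `1 ≤ λ`, `1 ≤ x ≤ exp(λ𝓛⁹)`:
`‖(log x) L(1+δ,χ) + L′(1+δ,χ) − L′(1,χ)(1 + δ log x)‖ ≤ (1 + 2λ)·C_res(K)·𝓛⁻⁶`, where
`C_res(K) = (1 + 16e^{9/2}π²K²) + 64e^{9/2}(K+1)π` is the constant of
`Lemma82.norm_residue_sub_main_le`. Proof: the expression is affine in `log x`; interpolate between the
tree's instances `x = 1` and `x = exp(𝓛⁹)`.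
[cite: Zhang2022LandauSiegel, §8, proof of Lemma 8.2 (residue at the double pole, via Lemma 5.8)] -/
theorem norm_residue_sub_main_le_of_le_exp_mul {D : ℕ} [NeZero D] (χ : DirichletCharacter ℂ D)
    (hprim : χ.IsPrimitive) (hL : 3 ≤ Real.log D) (hA : ‖χ.LFunction 1‖ ≤ 1 / Real.log D ^ 2022)
    {K : ℝ} (hK0 : 0 ≤ K) (hK : 4 * K * π ≤ Real.log D ^ 8) {δ : ℂ}
    (hδ : ‖δ‖ ≤ K * π / Real.log D ^ 9) {lam : ℝ} (hlam : 1 ≤ lam) {x : ℝ} (hx1 : 1 ≤ x)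
    (hxP : x ≤ Real.exp (lam * Real.log D ^ 9)) :
    ‖(Real.log x : ℂ) * χ.LFunction (1 + δ) + deriv χ.LFunction (1 + δ) -
        deriv χ.LFunction 1 * (1 + δ * Real.log x)‖ ≤
      (1 + 2 * lam) * (((1 + 16 * Real.exp (9 / 2) * π ^ 2 * K ^ 2) +
        64 * Real.exp (9 / 2) * (K + 1) * π) / Real.log D ^ 6) := by
  set Lg : ℝ := Real.log D with hLdef
  set Y : ℝ := Lg ^ 9 with hYdef
  have hL0 : 0 < Lg := by linarith
  have hY0 : 0 < Y := by positivity
  set Cr : ℝ := ((1 + 16 * Real.exp (9 / 2) * π ^ 2 * K ^ 2) +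
    64 * Real.exp (9 / 2) * (K + 1) * π) / Lg ^ 6 with hCrdef
  have hCr0 : 0 ≤ Cr := by positivity
  -- the two coefficients of the affine expression `E(y) = A y + B`, `y = log x`
  set A : ℂ := χ.LFunction (1 + δ) - deriv χ.LFunction 1 * δ with hAdef
  set B : ℂ := deriv χ.LFunction (1 + δ) - deriv χ.LFunction 1 with hBdef
  have hE : ∀ z : ℝ, (Real.log z : ℂ) * χ.LFunction (1 + δ) + deriv χ.LFunction (1 + δ) -
      deriv χ.LFunction 1 * (1 + δ * Real.log z) = A * (Real.log z : ℂ) + B := by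
    intro z; rw [hAdef, hBdef]; ring
  -- instance `x = 1`: `‖B‖ ≤ Cr`
  have h1 := norm_residue_sub_main_le χ hprim hL hA hK0 hK hδ (x := 1) le_rfl
    (by have := Real.exp_pos (Real.log D ^ 9); linarith [Real.add_one_le_exp (Real.log D ^ 9),
      show (0 : ℝ) ≤ Real.log D ^ 9 by positivity])
  rw [hE 1, Real.log_one] at h1
  simp only [Complex.ofReal_zero, mul_zero, zero_add] at h1
  -- instance `x = exp(𝓛⁹)`: `‖A Y + B‖ ≤ Cr`
  have h2 := norm_residue_sub_main_le χ hprim hL hA hK0 hK hδ (x := Real.exp (Real.log D ^ 9))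
    (by have := Real.add_one_le_exp (Real.log D ^ 9)
        have h0 : (0 : ℝ) ≤ Real.log D ^ 9 := by positivity
        linarith) le_rfl
  rw [hE, Real.log_exp] at h2
  -- the target point `y = log x ∈ [0, λ Y]`
  have hx0 : 0 < x := by linarith
  set y : ℝ := Real.log x with hydef
  have hy0 : 0 ≤ y := Real.log_nonneg hx1
  have hyY : y ≤ lam * Y := by
    have := Real.log_le_log hx0 hxP
    rwa [Real.log_exp] at this
  rw [hE x]
  -- `A y + B = B + (y / Y) • ((A Y + B) - B)`
  have hYC : ((Y : ℝ) : ℂ) ≠ 0 := by exact_mod_cast hY0.ne'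
  have hsplit : A * (y : ℂ) + B = B + ((y / Y : ℝ) : ℂ) * ((A * ((Lg ^ 9 : ℝ) : ℂ) + B) - B) := by
    rw [← hYdef]; push_cast; field_simp; ring
  rw [hsplit]
  have hyY' : y / Y ≤ lam := by rw [div_le_iff₀ hY0]; exact hyY
  have hyY0 : 0 ≤ y / Y := by positivity
  have hn : ‖((y / Y : ℝ) : ℂ)‖ = y / Y := by
    rw [Complex.norm_real, Real.norm_eq_abs, abs_of_nonneg hyY0]
  have h2' : ‖A * ((Lg ^ 9 : ℝ) : ℂ) + B‖ ≤ Cr := by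
    have : ((Lg ^ 9 : ℝ) : ℂ) = ((Real.log D ^ 9 : ℝ) : ℂ) := by rw [hLdef]
    rw [this]; exact_mod_cast h2
  calc ‖B + ((y / Y : ℝ) : ℂ) * ((A * ((Lg ^ 9 : ℝ) : ℂ) + B) - B)‖
      ≤ ‖B‖ + ‖((y / Y : ℝ) : ℂ) * ((A * ((Lg ^ 9 : ℝ) : ℂ) + B) - B)‖ := norm_add_le _ _
    _ = ‖B‖ + y / Y * ‖(A * ((Lg ^ 9 : ℝ) : ℂ) + B) - B‖ := by rw [norm_mul, hn]
    _ ≤ ‖B‖ + y / Y * (‖A * ((Lg ^ 9 : ℝ) : ℂ) + B‖ + ‖B‖) := by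
        gcongr; exact norm_sub_le _ _
    _ ≤ Cr + lam * (Cr + Cr) := by
        gcongr
    _ = (1 + 2 * lam) * Cr := by ring

/-! ### §2. The core estimate on the longer range (the Perron assembly re-run) -/

/-- **The core estimate on `T ≤ x ≤ P^λ`** (Lemma 8.2 with the factor `x^{β_μ}` removed): for `χ`
primitive mod `D`, `log D ≥ 3`, (A) `‖L(1,χ)‖ ≤ 𝓛^{-2022}`, `4Kπ ≤ 𝓛⁸`, `δ` purely imaginary with
`‖δ‖ ≤ Kα`, `1 ≤ λ`, and `T = exp(𝓛^{11/10}) ≤ x ≤ exp(λ𝓛⁹)`: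
`‖∑_{m ≤ x} χ(m) m^{-1-δ} log(x/m) − L′(1,χ)(1 + δ log x)‖ ≤ (1 + 2λ) C82(K) 𝓛^{-6}`.
Same proof as `Lemma82.sum_twist_log_sub_main_le` (Perron for the Riesz mean, shift to
`Re u = −1/𝓛`, double pole at `u = 0`), with the residue step taken from
`norm_residue_sub_main_le_of_le_exp_mul`.
[cite: Zhang2022LandauSiegel, §8, Lemma 8.2 (proof)] [cite: MontgomeryVaughan2007, §5.1] -/
theorem sum_twist_log_sub_main_le_of_le_exp_mul {D : ℕ} [NeZero D] (χ : DirichletCharacter ℂ D)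
    (hprim : χ.IsPrimitive) (hL : 3 ≤ Real.log D) (hA : ‖χ.LFunction 1‖ ≤ 1 / Real.log D ^ 2022)
    {K : ℝ} (hK0 : 0 ≤ K) (hK : 4 * K * π ≤ Real.log D ^ 8) {δ : ℂ} (hδre : δ.re = 0)
    (hδ : ‖δ‖ ≤ K * π / Real.log D ^ 9) {lam : ℝ} (hlam : 1 ≤ lam) {x : ℝ}
    (hxT : Real.exp (Real.log D ^ (11 / 10 : ℝ)) ≤ x)
    (hxP : x ≤ Real.exp (lam * Real.log D ^ 9)) :
    ‖(∑ m ∈ Finset.Ioc 0 ⌊x⌋₊, twist χ δ m * (Real.log (x / m) : ℂ)) -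
        deriv χ.LFunction 1 * (1 + δ * Real.log x)‖ ≤ (1 + 2 * lam) * C82 K / Real.log D ^ 6 := by
  have hD2 : 2 ≤ D := by
    rcases Nat.lt_or_ge D 2 with h | h
    · interval_cases D <;> norm_num at hL
    · exact h
  set Lg : ℝ := Real.log D with hLdef
  have hL0 : 0 < Lg := by linarith
  have hπ := Real.pi_pos
  have hχ1 : χ ≠ 1 := Lemma31.ne_one_of_isPrimitive χ hD2 hprim
  -- `x ≥ T ≥ 1`
  have hx1 : 1 ≤ x := by
    refine le_trans ?_ hxT
    have : (0 : ℝ) ≤ Lg ^ (11 / 10 : ℝ) := by positivity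
    calc (1 : ℝ) = Real.exp 0 := (Real.exp_zero).symm
      _ ≤ Real.exp (Lg ^ (11 / 10 : ℝ)) := Real.exp_le_exp.2 this
  have hx0 : 0 < x := by linarith
  -- `‖δ‖ ≤ 1`
  have hδ1 : ‖δ‖ ≤ 1 := by
    refine hδ.trans ?_
    rw [div_le_one (by positivity)]
    have h9 : Lg ^ 8 ≤ Lg ^ 9 := by
      calc Lg ^ 8 = Lg ^ 8 * 1 := (mul_one _).symm
        _ ≤ Lg ^ 8 * Lg := by gcongr; linarith
        _ = Lg ^ 9 := by ring
    nlinarith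
  set η : ℝ := 1 / Lg with hηdef
  have hη0 : 0 < η := by positivity
  have hη2 : η ≤ 1 / 2 := by rw [hηdef, div_le_div_iff₀ hL0 (by norm_num)]; linarith
  -- the line shift across the double pole at `0`
  have hstrip := Literature.Analysis.Complex.integral_vertical_sub_eq_sum_of_poles_dslope
    (F := G χ δ x) (σ₁ := -η) (κ := 1) (by linarith) ({0} : Finset ℂ) (fun _ => 1)
    (fun _ => phi χ δ x) univ isOpen_univ (subset_univ _)
    (fun p hp => by
      rw [Finset.mem_singleton] at hp; subst hp
      simp only [Complex.zero_re]; exact ⟨by linarith, one_pos⟩)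
    (by
      rw [Finset.coe_singleton]
      intro z hz
      have hz0 : z ≠ 0 := by simpa using hz
      exact (differentiableAt_G χ hχ1 δ hx0 hz0).differentiableWithinAt)
    (fun p hp => by
      rw [Finset.mem_singleton] at hp
      subst hp
      exact ⟨univ, univ_mem, (differentiable_phi χ hχ1 δ hx0).differentiableOn,
        fun z _ _ => G_eq_phi_div χ δ x z⟩)
    (integrable_G_right χ hχ1 hδre hx0)
    (integrable_G_left χ hL hχ1 hδre hδ1 hx0)
    (G_horizontal_decay χ hχ1 hδre hδ1 hx1 hη2)
  rw [Finset.sum_singleton, residue_eq χ hχ1 δ hx0] at hstrip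
  -- Perron
  have hperron := sum_eq_integral χ hδre hx0
  have e1 : (∫ t : ℝ, G χ δ x (((1 : ℝ) : ℂ) + t * I)) = ∫ t : ℝ, G χ δ x (1 + t * I) := by
    norm_num
  rw [e1] at hstrip
  set Ileft := ∫ t : ℝ, G χ δ x ((((-η : ℝ)) : ℂ) + t * I) with hIleft
  set R := (Real.log x : ℂ) * χ.LFunction (1 + δ) + deriv χ.LFunction (1 + δ) with hR
  have hint : (∫ t : ℝ, G χ δ x (1 + t * I)) = Ileft + 2 * π * R := by
    rw [← hstrip]; ring
  have hπ0 : (π : ℂ) ≠ 0 := by exact_mod_cast hπ.ne'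
  have hS : (∑ m ∈ Finset.Ioc 0 ⌊x⌋₊, twist χ δ m * (Real.log (x / m) : ℂ)) =
      (1 / (2 * π) : ℂ) * Ileft + R := by
    rw [hperron, hint, mul_add]
    congr 1
    field_simp
  rw [hS, show (1 / (2 * π) : ℂ) * Ileft + R - deriv χ.LFunction 1 * (1 + δ * Real.log x) =
    (1 / (2 * π) : ℂ) * Ileft + (R - deriv χ.LFunction 1 * (1 + δ * Real.log x)) by ring]
  -- the two error terms
  have hres := norm_residue_sub_main_le_of_le_exp_mul χ hprim hL hA hK0 hK hδ hlam hx1 hxP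
  have hleft := norm_integral_G_left_le χ hL hχ1 hδre hδ1 hx0
  have hxfac := rpow_neg_inv_log_mul_le hL hxT
  have hnorm2π : ‖(1 / (2 * π) : ℂ)‖ = 1 / (2 * π) := by
    rw [norm_div, norm_one, norm_mul, Complex.norm_real, Real.norm_eq_abs, abs_of_pos hπ]
    norm_num
  have hI0 := I0_nonneg
  have hlam0 : 0 ≤ lam := by linarith
  -- the Perron piece is scaled up by `1 + 2λ ≥ 1`
  have hP1 : 1 / (2 * π) * (4 / 9 * Real.exp 1 * I0) * ((Nat.factorial 90 : ℝ) / Lg ^ 6) ≤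
      (1 + 2 * lam) * (1 / (2 * π) * (4 / 9 * Real.exp 1 * I0) * ((Nat.factorial 90 : ℝ) / Lg ^ 6)) :=
    le_mul_of_one_le_left (by positivity) (by linarith)
  calc ‖(1 / (2 * π) : ℂ) * Ileft + (R - deriv χ.LFunction 1 * (1 + δ * Real.log x))‖
      ≤ ‖(1 / (2 * π) : ℂ) * Ileft‖ + ‖R - deriv χ.LFunction 1 * (1 + δ * Real.log x)‖ :=
        norm_add_le _ _
    _ ≤ 1 / (2 * π) * (x ^ (-(1 / Lg)) * (4 / 9 * Real.exp 1 * Lg ^ 3) * I0) +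
        (1 + 2 * lam) * (((1 + 16 * Real.exp (9 / 2) * π ^ 2 * K ^ 2) +
          64 * Real.exp (9 / 2) * (K + 1) * π) / Lg ^ 6) := by
        rw [norm_mul, hnorm2π]
        exact add_le_add (mul_le_mul_of_nonneg_left hleft (by positivity)) hres
    _ = 1 / (2 * π) * (4 / 9 * Real.exp 1 * I0) * (x ^ (-(1 / Lg)) * Lg ^ 3) +
        (1 + 2 * lam) * (((1 + 16 * Real.exp (9 / 2) * π ^ 2 * K ^ 2) +
          64 * Real.exp (9 / 2) * (K + 1) * π) / Lg ^ 6) := by ring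
    _ ≤ 1 / (2 * π) * (4 / 9 * Real.exp 1 * I0) * ((Nat.factorial 90 : ℝ) / Lg ^ 6) +
        (1 + 2 * lam) * (((1 + 16 * Real.exp (9 / 2) * π ^ 2 * K ^ 2) +
          64 * Real.exp (9 / 2) * (K + 1) * π) / Lg ^ 6) := by
        gcongr
    _ ≤ (1 + 2 * lam) * (1 / (2 * π) * (4 / 9 * Real.exp 1 * I0) *
          ((Nat.factorial 90 : ℝ) / Lg ^ 6)) +
        (1 + 2 * lam) * (((1 + 16 * Real.exp (9 / 2) * π ^ 2 * K ^ 2) +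
          64 * Real.exp (9 / 2) * (K + 1) * π) / Lg ^ 6) := by linarith [hP1]
    _ = (1 + 2 * lam) * C82 K / Lg ^ 6 := by rw [C82]; ring

/-! ### §3. Lemma 8.2 on the longer range: general shifts, printed shifts, the `ϰ`-form -/

/-- **Lemma 8.2 (general shifts) on `T ≤ x ≤ P^λ`.** For `χ` primitive mod `D`, `𝓛 = log D ≥ 3`,
(A) `‖L(1,χ)‖ ≤ 𝓛^{-2022}`, `K ≥ 0` with `8Kπ ≤ 𝓛⁸`, purely imaginary shifts `β, β′` with
`‖β‖, ‖β′‖ ≤ Kα` (`α = π𝓛^{-9}`), `1 ≤ λ`, and `T = exp(𝓛^{1.1}) ≤ x ≤ exp(λ𝓛⁹) = P^λ`: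
`‖∑_{m ≤ x} χ(m) m^{β−1} (x/m)^{β′} log(x/m) − L′(1,χ) 𝔣(x)‖ ≤ (1 + 2λ) C82(2K) 𝓛^{-6}`,
`𝔣(x) = (1 + (β′ − β) log x) x^{β′}`. (The printed lemma is `λ = 1`: `Lemma82.lemma_8_2_general`.)
[cite: Zhang2022LandauSiegel, §8, Lemma 8.2] -/
theorem lemma_8_2_general_of_le_exp_mul {D : ℕ} [NeZero D] (χ : DirichletCharacter ℂ D)
    (hprim : χ.IsPrimitive) (hL : 3 ≤ Real.log D) (hA : ‖χ.LFunction 1‖ ≤ 1 / Real.log D ^ 2022)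
    {K : ℝ} (hK0 : 0 ≤ K) (hK : 8 * K * π ≤ Real.log D ^ 8) {β β' : ℂ} (hβre : β.re = 0)
    (hβ're : β'.re = 0) (hβ : ‖β‖ ≤ K * π / Real.log D ^ 9) (hβ' : ‖β'‖ ≤ K * π / Real.log D ^ 9)
    {lam : ℝ} (hlam : 1 ≤ lam) {x : ℝ} (hxT : Real.exp (Real.log D ^ (11 / 10 : ℝ)) ≤ x)
    (hxP : x ≤ Real.exp (lam * Real.log D ^ 9)) :
    ‖(∑ m ∈ Finset.Ioc 0 ⌊x⌋₊, χ (m : ZMod D) * (m : ℂ) ^ (β - 1) * (((x / m : ℝ)) : ℂ) ^ β' *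
        (Real.log (x / m) : ℂ)) - deriv χ.LFunction 1 * frakf β β' (Real.log x)‖ ≤
      (1 + 2 * lam) * C82 (2 * K) / Real.log D ^ 6 := by
  have hx0 : 0 < x := lt_of_lt_of_le (Real.exp_pos _) hxT
  set δ : ℂ := β' - β with hδdef
  have hδre : δ.re = 0 := by simp [hδdef, hβre, hβ're]
  have hδ : ‖δ‖ ≤ 2 * K * π / Real.log D ^ 9 := by
    calc ‖δ‖ ≤ ‖β'‖ + ‖β‖ := norm_sub_le _ _
      _ ≤ K * π / Real.log D ^ 9 + K * π / Real.log D ^ 9 := add_le_add hβ' hβ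
      _ = 2 * K * π / Real.log D ^ 9 := by ring
  have hcore := sum_twist_log_sub_main_le_of_le_exp_mul χ hprim hL hA (K := 2 * K) (by positivity)
    (by linarith) hδre hδ hlam hxT hxP
  -- rewrite the printed sum and main term through `x^{β′}`
  have hsum : (∑ m ∈ Finset.Ioc 0 ⌊x⌋₊, χ (m : ZMod D) * (m : ℂ) ^ (β - 1) *
      (((x / m : ℝ)) : ℂ) ^ β' * (Real.log (x / m) : ℂ)) =
      cexp (β' * (Real.log x : ℂ)) *
        ∑ m ∈ Finset.Ioc 0 ⌊x⌋₊, twist χ δ m * (Real.log (x / m) : ℂ) := by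
    rw [Finset.mul_sum]
    refine Finset.sum_congr rfl fun m hm => ?_
    have hm0 : m ≠ 0 := Nat.pos_iff_ne_zero.1 (Finset.mem_Ioc.1 hm).1
    rw [hδdef]
    exact summand_eq χ β β' hx0 hm0
  have hmain : frakf β β' (Real.log x) =
      cexp (β' * (Real.log x : ℂ)) * (1 + δ * (Real.log x : ℂ)) := by
    rw [frakf, hδdef]; ring
  rw [hsum, hmain, ← mul_assoc, mul_comm (deriv χ.LFunction 1) (cexp _), mul_assoc, ← mul_sub,
    norm_mul, norm_cexp_imag_mul_log hβ're, one_mul]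
  exact hcore

/-- **Lemma 8.2 (printed shifts) on `T ≤ x ≤ P^λ`**: for `β_j ∈ {β₁,β₂,β₃}(c′)`, `β_μ ∈ {β₆,β₇}`
(`β₆ = (3/2)iα`, `β₇ = (5/2)iα`), `8(3+5c′)π ≤ 𝓛⁸`, `1 ≤ λ` and `T ≤ x ≤ exp(λ𝓛⁹)`:
`‖∑_{m ≤ x} χ(m) m^{β_j−1} (x/m)^{β_μ} log(x/m) − L′(1,χ) 𝔣_{jμ}(x)‖ ≤ C 𝓛^{-6}` with
`C = (1 + 2λ) C82(2(3+5c′))` depending on `c′` and `λ` only. (`λ = 1` is `Lemma82.lemma_8_2`.)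
[cite: Zhang2022LandauSiegel, §8, Lemma 8.2] -/
theorem lemma_8_2_of_le_exp_mul {c' : ℝ} (hc' : 0 ≤ c') {lam : ℝ} (hlam : 1 ≤ lam) :
    ∃ C : ℝ, ∀ (D : ℕ) [NeZero D]
    (χ : DirichletCharacter ℂ D), χ.IsPrimitive → 3 ≤ Real.log D →
    ‖χ.LFunction 1‖ ≤ 1 / Real.log D ^ 2022 → 8 * (3 + 5 * c') * π ≤ Real.log D ^ 8 →
    ∀ βj ∈ ({beta1 c' (Real.log D), beta2 c' (Real.log D), beta3 c' (Real.log D)} : Set ℂ),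
    ∀ βμ ∈ ({betaMain (3 / 2) (π / Real.log D ^ 9), betaMain (5 / 2) (π / Real.log D ^ 9)} : Set ℂ),
    ∀ x : ℝ, Real.exp (Real.log D ^ (11 / 10 : ℝ)) ≤ x → x ≤ Real.exp (lam * Real.log D ^ 9) →
    ‖(∑ m ∈ Finset.Ioc 0 ⌊x⌋₊, χ (m : ZMod D) * (m : ℂ) ^ (βj - 1) * (((x / m : ℝ)) : ℂ) ^ βμ *
        (Real.log (x / m) : ℂ)) - deriv χ.LFunction 1 * frakf βj βμ (Real.log x)‖ ≤
      C / Real.log D ^ 6 := by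
  refine ⟨(1 + 2 * lam) * C82 (2 * (3 + 5 * c')),
    fun D _ χ hprim hL hA hD βj hβj βμ hβμ x hxT hxP => ?_⟩
  have hall := shifts_bound hc' hL
  have hj := hall βj (by
    simp only [Set.mem_insert_iff, Set.mem_singleton_iff] at hβj ⊢; tauto)
  have hμ := hall βμ (by
    simp only [Set.mem_insert_iff, Set.mem_singleton_iff] at hβμ ⊢; tauto)
  exact lemma_8_2_general_of_le_exp_mul χ hprim hL hA (K := 3 + 5 * c') (by positivity)
    (by linarith) hj.1 hμ.1 hj.2 hμ.2 hlam hxT hxP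

/-- **Lemma 8.2 in the consumed `ϰ`-form at levels `P₁ ≤ P^λ`** [the display after Lemma 8.4,
"By Lemma 8.2 with `x = P₁/dr` …"]: for any level `P₁ ≤ exp(λ𝓛⁹)` (`1 ≤ λ`), any `k ≥ 1` with
`kT ≤ P₁`, and purely imaginary shifts `‖β_j‖, ‖β_μ‖ ≤ Kα` (`8Kπ ≤ 𝓛⁸`):
`‖∑_m χ(m)ϰ(km)m^{β_j−1} − (L′(1,χ)/log P₁)·𝔣(P₁/k)‖ ≤ (1 + 2λ) C82(2K)/(𝓛⁶ log P₁)`.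
(`λ = 1` is `Lemma82.lemma_8_2_varkappa`.)
[cite: Zhang2022LandauSiegel, §8, Lemma 8.2 and the display after Lemma 8.4] -/
theorem lemma_8_2_varkappa_of_le_exp_mul {D : ℕ} [NeZero D] (χ : DirichletCharacter ℂ D)
    (hprim : χ.IsPrimitive) (hL : 3 ≤ Real.log D) (hA : ‖χ.LFunction 1‖ ≤ 1 / Real.log D ^ 2022)
    {K : ℝ} (hK0 : 0 ≤ K) (hK : 8 * K * π ≤ Real.log D ^ 8) {βj βμ : ℂ} (hβjre : βj.re = 0)
    (hβμre : βμ.re = 0) (hβj : ‖βj‖ ≤ K * π / Real.log D ^ 9) (hβμ : ‖βμ‖ ≤ K * π / Real.log D ^ 9)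
    {lam : ℝ} (hlam : 1 ≤ lam) {P₁ : ℝ} (hP₁P : P₁ ≤ Real.exp (lam * Real.log D ^ 9)) {k : ℕ}
    (hk : 1 ≤ k) (hkT : Real.exp (Real.log D ^ (11 / 10 : ℝ)) * k ≤ P₁) :
    ‖(∑ m ∈ Finset.Ioc 0 ⌊P₁ / k⌋₊, χ (m : ZMod D) * varkappa P₁ βμ (k * m) * (m : ℂ) ^ (βj - 1)) -
        deriv χ.LFunction 1 / (Real.log P₁ : ℂ) * frakf βj βμ (Real.log (P₁ / k))‖ ≤
      (1 + 2 * lam) * C82 (2 * K) / (Real.log D ^ 6 * Real.log P₁) := by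
  have hk0 : (0 : ℝ) < k := by exact_mod_cast hk
  have hT1 : 1 < Real.exp (Real.log D ^ (11 / 10 : ℝ)) := by
    have : (0 : ℝ) < Real.log D ^ (11 / 10 : ℝ) := Real.rpow_pos_of_pos (by linarith) _
    exact Real.one_lt_exp_iff.2 this
  have hT0 : 0 < Real.exp (Real.log D ^ (11 / 10 : ℝ)) := Real.exp_pos _
  set x : ℝ := P₁ / k with hxdef
  have hxT : Real.exp (Real.log D ^ (11 / 10 : ℝ)) ≤ x := by
    rw [hxdef, le_div_iff₀ hk0]; exact hkT
  have hx1 : 1 < x := lt_of_lt_of_le hT1 hxT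
  have hP₁1 : 1 < P₁ := by
    have h1 : (1 : ℝ) ≤ k := by exact_mod_cast hk
    have hP0 : 0 ≤ P₁ := le_trans (by positivity) hkT
    have : x ≤ P₁ := by rw [hxdef]; exact div_le_self hP0 h1
    linarith
  have hlogP : 0 < Real.log P₁ := Real.log_pos hP₁1
  have hxP : x ≤ Real.exp (lam * Real.log D ^ 9) := by
    refine le_trans ?_ hP₁P
    rw [hxdef]; exact div_le_self (by linarith) (by exact_mod_cast hk)
  have hgen := lemma_8_2_general_of_le_exp_mul χ hprim hL hA hK0 hK hβjre hβμre hβj hβμ hlam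
    hxT hxP
  -- the sum is `(1/log P₁)` times the sum of Lemma 8.2 at `x = P₁/k`
  have hsum : (∑ m ∈ Finset.Ioc 0 ⌊P₁ / k⌋₊, χ (m : ZMod D) * varkappa P₁ βμ (k * m) *
      (m : ℂ) ^ (βj - 1)) = (1 / (Real.log P₁ : ℂ)) *
      ∑ m ∈ Finset.Ioc 0 ⌊x⌋₊, χ (m : ZMod D) * (m : ℂ) ^ (βj - 1) * (((x / m : ℝ)) : ℂ) ^ βμ *
        (Real.log (x / m) : ℂ) := by
    rw [← hxdef, Finset.mul_sum]
    refine Finset.sum_congr rfl fun m hm => ?_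
    have hm1 : 1 ≤ m := (Finset.mem_Ioc.1 hm).1
    have hmx : (m : ℝ) ≤ x := by
      have := (Finset.mem_Ioc.1 hm).2
      exact le_trans (by exact_mod_cast this) (Nat.floor_le (by linarith))
    rw [varkappa_mul_eq hP₁1 βμ hk hm1 (by rwa [hxdef] at hmx), ← hxdef]
    push_cast
    field_simp
  have hlogC : (Real.log P₁ : ℂ) ≠ 0 := by exact_mod_cast hlogP.ne'
  rw [hsum, show (1 / (Real.log P₁ : ℂ)) * (∑ m ∈ Finset.Ioc 0 ⌊x⌋₊, χ (m : ZMod D) *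
      (m : ℂ) ^ (βj - 1) * (((x / m : ℝ)) : ℂ) ^ βμ * (Real.log (x / m) : ℂ)) -
      deriv χ.LFunction 1 / (Real.log P₁ : ℂ) * frakf βj βμ (Real.log x) =
      (1 / (Real.log P₁ : ℂ)) * ((∑ m ∈ Finset.Ioc 0 ⌊x⌋₊, χ (m : ZMod D) *
      (m : ℂ) ^ (βj - 1) * (((x / m : ℝ)) : ℂ) ^ βμ * (Real.log (x / m) : ℂ)) -
      deriv χ.LFunction 1 * frakf βj βμ (Real.log x)) by field_simp, norm_mul]
  have hn : ‖(1 / (Real.log P₁ : ℂ))‖ = 1 / Real.log P₁ := by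
    rw [norm_div, norm_one, Complex.norm_real, Real.norm_eq_abs, abs_of_pos hlogP]
  rw [hn, div_mul_eq_div_div, le_div_iff₀ hlogP]
  calc 1 / Real.log P₁ * ‖(∑ m ∈ Finset.Ioc 0 ⌊x⌋₊, χ (m : ZMod D) * (m : ℂ) ^ (βj - 1) *
        (((x / m : ℝ)) : ℂ) ^ βμ * (Real.log (x / m) : ℂ)) - deriv χ.LFunction 1 * frakf βj βμ
          (Real.log x)‖ * Real.log P₁
      = ‖(∑ m ∈ Finset.Ioc 0 ⌊x⌋₊, χ (m : ZMod D) * (m : ℂ) ^ (βj - 1) *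
        (((x / m : ℝ)) : ℂ) ^ βμ * (Real.log (x / m) : ℂ)) - deriv χ.LFunction 1 * frakf βj βμ
          (Real.log x)‖ := by field_simp
    _ ≤ (1 + 2 * lam) * C82 (2 * K) / Real.log D ^ 6 := hgen

/-- **The printed range as the case `λ = 1`** (consistency check with the tree's statement): on
`T ≤ x ≤ P` the extended core estimate gives the bound `3·C82(K)𝓛⁻⁶`
(while `Lemma82.sum_twist_log_sub_main_le` gives `C82(K)𝓛⁻⁶`).
[cite: Zhang2022LandauSiegel, §8, Lemma 8.2] -/
theorem sum_twist_log_sub_main_le_of_le_exp {D : ℕ} [NeZero D] (χ : DirichletCharacter ℂ D)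
    (hprim : χ.IsPrimitive) (hL : 3 ≤ Real.log D) (hA : ‖χ.LFunction 1‖ ≤ 1 / Real.log D ^ 2022)
    {K : ℝ} (hK0 : 0 ≤ K) (hK : 4 * K * π ≤ Real.log D ^ 8) {δ : ℂ} (hδre : δ.re = 0)
    (hδ : ‖δ‖ ≤ K * π / Real.log D ^ 9) {x : ℝ}
    (hxT : Real.exp (Real.log D ^ (11 / 10 : ℝ)) ≤ x) (hxP : x ≤ Real.exp (Real.log D ^ 9)) :
    ‖(∑ m ∈ Finset.Ioc 0 ⌊x⌋₊, twist χ δ m * (Real.log (x / m) : ℂ)) -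
        deriv χ.LFunction 1 * (1 + δ * Real.log x)‖ ≤ 3 * C82 K / Real.log D ^ 6 := by
  have h := sum_twist_log_sub_main_le_of_le_exp_mul χ hprim hL hA hK0 hK hδre hδ (lam := 1) le_rfl
    hxT (by rwa [one_mul])
  norm_num at h
  linarith

end Literature.NumberTheory.LFunctions.Zhang2022.Lemma82
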